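import Literature.NumberTheory.Automorphic.RankinSelbergTowerFiniteness
import Literature.NumberTheory.Automorphic.JacquetShalikaEulerProductsProofs
import HarnessLib

/-!
# Jacquet–Shalika's Theorem (5.3) for the standard Euler product: the discharges

Topic `NumberTheory/Automorphic`; namespace `Literature.NumberTheory.Automorphic`. Proof file
(theorems only: no definition, no named fact, no instance), sibling of `AutomorphicLFunction` /
`AutomorphicLFunctionProofs` (which are *upstream* of the Rankin–Selberg files, so the discharges
cannot be appended there without an import cycle).

Jacquet–Shalika, *On Euler products and the classification of automorphic representations I*,
Amer. J. Math. **103** (1981), Thm. (5.3) with Remark (5.4) (case `p = 1`, `π' = 1`): for a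
(unitary) cuspidal automorphic representation `π` of `GL_n(𝔸_K)` the Euler product
`L_S(s, π) = ∏_{v ∉ S} det(1 - q_v^{-s} A_v)⁻¹` converges absolutely for `Re(s) > 1`. The printed
proof (p. 556): by Lemma (5.2) (continuation of `L_S(s, π × π̄)` to `Re(s) > 1`, from the
Rankin–Selberg integral of §4) and Landau's lemma, the Dirichlet series with non-negative
coefficients `∑_{v ∉ S} ∑_{k ≥ 1} |tr A_v^k|² / (k q_v^{ks})` ((5.3.3)) converges for `Re(s) > 1`
((5.3.4)); Cauchy–Schwarz ((5.3.5)) then bounds `log L_S(s, π × π')`.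

In the tree the whole argument is assembled over the honest objects (`CuspidalAutomorphicRepGL` =
irreducible closed subrepresentations of `L²_cusp(GL_n(K) A_G \ GL_n(𝔸_K))`, Satake parameters =
spherical Hecke eigenvalues): the keystone `JacquetShalika1981_schurSelfSum_prod_bounded_holds` of
`RankinSelbergTowerFiniteness` (boundedness of the unramified Rankin–Selberg torus-sum products at
every real `σ > 1`, in every rank, from the finiteness of the unfolded Rankin–Selberg integral of
the Whittaker coefficients of smoothed cusp forms — reduction theory, rapid decay, the mirabolic
Eisenstein weight) feeds the reductions already landed in `JacquetShalikaSchurSelfSum` (torus sums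
⇒ the junction (J) = (5.3.3)–(5.3.4) off large finite sets, by the Cauchy identity for Schur
polynomials), `JacquetShalikaLargeFinset` ((J) ⇒ (5.1.3) off large `S` ⇒ absolute convergence, the
finitely many exceptional factors put back) and `JacquetShalikaLargeFinsetProofs` /
`JacquetShalikaEulerProductsProofs` ((J) ⇒ the real-quotient statement and Lemma (5.2) as recorded,
`exp` of a convergent Dirichlet series). This file records the resulting **unconditional theorems**
(axioms `propext`, `Classical.choice`, `Quot.sound` only):

* `StandardLFunctionData.multipliable_L_holds` — the named fact `StandardLFunctionData.multipliable_L`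
  of `AutomorphicLFunction`: the full Euler product `∏_v P_v(q_v^{-s})⁻¹` of every standard
  `L`-function datum of a cuspidal `Π` of `GL_n(𝔸_K)` is multipliable for `re s > 1`;
* `multipliable_partialStandardL_holds` (`AutomorphicLFunction`),
  `absolutelyConvergent_partialStandardL_holds` (`AutomorphicLFunctionProofs`),
  `StandardLFunctionData.L_eq_partialStandardL_mul_holds` (`AutomorphicLFunction`) — the partial
  standard Euler product off any `S` carrying a Satake family is absolutely convergent, hence
  multipliable, on `re s > 1`, and `L(s, Π) = (∏_{v ∈ S} P_v(q_v^{-s})⁻¹) · L^S(s, Π)` there;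
* `summable_normSq_trace_largeFinset_holds` (`JacquetShalikaLargeFinset`) — (J): (5.3.3) converges
  for `σ > 1` off large finite `S`;
* `JacquetShalika1981_continuation_partialPairL_conj_holds` (`JacquetShalikaEulerProducts`) —
  Lemma (5.2) as recorded in the tree (`L_S(s, π × π̄)` agrees far to the right with a function
  holomorphic on `re s > 1`), and `JacquetShalika1981_realQuotient_partialPairL_conj_holds`
  (`JacquetShalikaLargeFinset`) — its real-point quotient form.

Ranks `n ≤ 1` were unconditional before (`SatakeParameterUnitBound`), rank `2` by the mean-square
method (`MultipliableLGL2`); the present theorems cover every rank uniformly. What is deliberately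
NOT here: the arbitrary-`S` series fact `summable_normSq_trace_satakePow` and the local bound
`norm_satakeParameter_le_sqrt` ((5.1.3) at *every* unramified place) of `AutomorphicLFunctionProofs`,
which need the local generic bound of loc. cit. Cor. (2.5) at the finitely many unramified places
inside `S₀` and do not follow from (J) alone.

## References

* H. Jacquet, J. A. Shalika, *On Euler products and the classification of automorphic
  representations I*, Amer. J. Math. 103 (1981), 499–558: Lemma (5.2) p. 554, Thm. (5.3) p. 555,
  its proof (5.3.3)–(5.3.5) p. 556, Remark (5.4) p. 557 [JacquetShalikaAJM1981].
* J. W. Cogdell, *Analytic theory of L-functions for GL_n*, in: J. Bernstein, S. Gelbart (eds.),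
  *An Introduction to the Langlands Program*, Birkhäuser (2004), §2.3, §4.1
  [CogdellAnalyticTheory2004].
-/

noncomputable section

open MeasureTheory

namespace Literature.NumberTheory.Automorphic

section Discharges

variable {n : ℕ} {K : Type} [Field K] [NumberField K]
  {μ : Measure (AdelicGroupData.gl n K).automorphicQuotient}
  [(AdelicGroupData.gl n K).IsAutomorphicMeasure μ] {P : CuspidalAutomorphicRepGL n K μ}

/-- **Jacquet–Shalika's Theorem (5.3) for the full standard Euler product** — the named fact
`StandardLFunctionData.multipliable_L` of `AutomorphicLFunction` is a theorem: for every cuspidal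
automorphic representation `Π` of `GL_n(𝔸_K)` (any `n`, any number field `K`) and every standard
`L`-function datum `D` of `Π`, the Euler product `∏_v P_v(q_v^{-s})⁻¹` over all finite places is
multipliable for `re s > 1`. From the bounded Rankin–Selberg torus-sum products
(`JacquetShalika1981_schurSelfSum_prod_bounded_holds`, every rank) by
`StandardLFunctionData.multipliable_L_of_schurSelfSum_prod_bounded` ((J), (5.1.3) off large `S`,
absolute convergence, the finitely many exceptional factors put back).
[cite: JacquetShalikaAJM1981, Thm. (5.3), Remark (5.4)] -/
theorem StandardLFunctionData.multipliable_L_holds : StandardLFunctionData.multipliable_L (P := P) :=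
  StandardLFunctionData.multipliable_L_of_schurSelfSum_prod_bounded
    JacquetShalika1981_schurSelfSum_prod_bounded_holds

/-- **Jacquet–Shalika's Theorem (5.3), partial Euler product** — the named fact
`multipliable_partialStandardL` of `AutomorphicLFunction`: for a cuspidal `Π` of `GL_n(𝔸_K)` and a
Satake family `α` of `Π` off `S`, `∏_{v ∉ S} ∏_{a ∈ α v} (1 - a q_v^{-s})⁻¹` is multipliable for
`re s > 1`. [cite: JacquetShalikaAJM1981, Thm. (5.3), Remark (5.4)] -/
theorem multipliable_partialStandardL_holds : multipliable_partialStandardL (μ := μ) :=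
  multipliable_partialStandardL_of_schurSelfSum_prod_bounded
    JacquetShalika1981_schurSelfSum_prod_bounded_holds

/-- **Jacquet–Shalika's Theorem (5.3), absolute convergence** — the named fact
`absolutelyConvergent_partialStandardL` of `AutomorphicLFunctionProofs`:
`∑_{v ∉ S} ‖L(s, Π_v) - 1‖ < ∞` for `re s > 1` ("`L_S(s, π × π')` is absolutely convergent in the
half-plane `Re(s) > 1`", case `π' = 1`). [cite: JacquetShalikaAJM1981, Thm. (5.3), Remark (5.4)] -/
theorem absolutelyConvergent_partialStandardL_holds :
    absolutelyConvergent_partialStandardL (μ := μ) :=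
  absolutelyConvergent_partialStandardL_of_schurSelfSum_prod_bounded
    JacquetShalika1981_schurSelfSum_prod_bounded_holds

/-- **`L(s, Π) = (∏_{v ∈ S} P_v(q_v^{-s})⁻¹) · L^S(s, Π)` for `re s > 1`** — the named fact
`StandardLFunctionData.L_eq_partialStandardL_mul` of `AutomorphicLFunction` (splitting the now
multipliable `tprod` into the finite exceptional product and the complementary partial standard
`L`-function). [cite: JacquetShalikaAJM1981, §1] -/
theorem StandardLFunctionData.L_eq_partialStandardL_mul_holds :
    StandardLFunctionData.L_eq_partialStandardL_mul (P := P) :=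
  StandardLFunctionData.L_eq_partialStandardL_mul_of_schurSelfSum_prod_bounded
    JacquetShalika1981_schurSelfSum_prod_bounded_holds

/-- **(J): Jacquet–Shalika's (5.3.3)–(5.3.4) off large finite sets** — the named fact
`summable_normSq_trace_largeFinset` of `JacquetShalikaLargeFinset`: for every cuspidal `Π` there is
a finite `S₀` such that for all finite `S ⊇ S₀` and Satake families `α` of `Π` off `S`,
`∑_{v ∉ S} ∑_{k ≥ 1} |tr A_v^k|² / (k q_v^{kσ}) < ∞` for every `σ > 1`.
[cite: JacquetShalikaAJM1981, Thm. (5.3), proof, (5.3.3)–(5.3.4), p. 556] -/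
theorem summable_normSq_trace_largeFinset_holds : summable_normSq_trace_largeFinset (μ := μ) :=
  summable_normSq_trace_largeFinset_of_schurSelfSum_prod_bounded
    JacquetShalika1981_schurSelfSum_prod_bounded_holds

/-- **Jacquet–Shalika's Lemma (5.2)** as recorded in the tree — the named fact
`JacquetShalika1981_continuation_partialPairL_conj` of `JacquetShalikaEulerProducts`: for every
cuspidal `Π` of `GL_n(𝔸_K)` there is a finite `S₀` such that for all finite `S ⊇ S₀` and Satake
families `α` of `Π` off `S`, `L_S(s, π × π̄) = ∏_{v ∉ S} det(1 - q_v^{-s} A_v ⊗ Ā_v)⁻¹` agrees on a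
right half-plane with a function holomorphic on `re s > 1` (here `exp` of the Dirichlet series
(5.3.3), convergent by (J)). [cite: JacquetShalikaAJM1981, Lemma (5.2), (5.1), p. 554] -/
theorem JacquetShalika1981_continuation_partialPairL_conj_holds :
    JacquetShalika1981_continuation_partialPairL_conj (μ := μ) :=
  JacquetShalika1981_continuation_partialPairL_conj_of_schurSelfSum_prod_bounded
    JacquetShalika1981_schurSelfSum_prod_bounded_holds

/-- **The real-point quotient form of Lemma (5.2)** — the named fact
`JacquetShalika1981_realQuotient_partialPairL_conj` of `JacquetShalikaLargeFinset` (at every real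
`σ₀ > 1`, `I = A · L_S(s, α × ᾱ)` far to the right with `I`, `A` holomorphic on `re s > 1` and
`A(σ₀) ≠ 0`; here `A = 1`). [cite: JacquetShalikaAJM1981, Lemma (5.2), proof, p. 555] -/
theorem JacquetShalika1981_realQuotient_partialPairL_conj_holds :
    JacquetShalika1981_realQuotient_partialPairL_conj (μ := μ) :=
  JacquetShalika1981_realQuotient_of_schurSelfSum_prod_bounded
    JacquetShalika1981_schurSelfSum_prod_bounded_holds

end Discharges

end Literature.NumberTheory.Automorphic
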